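import Summits.ValiantsHypothesis.ValiantsHypothesis.Theorems.RigidityForcesSymmetryGrenetFirstOrderRankRigidBorderShape

/-!
# Route RigidityForcesSymmetry — `GrenetFirstOrderRankRigid` (item stmt-ValiantsHypothesis-21029),
line `grenet_gauge`: stub `stub_linearRigid`, step 5 (block II) — orderings with a prescribed chain of
prefix sets

For the crux line `Cruxes/GrenetFirstOrderRankRigid/Lines/grenet_gauge.lean` (blueprint
`Lines/grenet_gauge-stub_linearRigid-PROOF.md`, §5, block II designs).  The permutation designs of the
type-II blocks are orderings `π` of `Fin n` with several prescribed PREFIX SETS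
`π({i < s₁}) = L₁ ⊆ π({i < s₂}) = L₂ ⊆ …`.  Tools: `exists_perm_prefix_insert_eqOn` (extend a prefix by
one prescribed letter without moving the earlier positions — `Grenet.exists_perm_prefix_image_insert`
with the pointwise agreement exposed), `exists_perm_prefix_extend` (extend the `s`-prefix of `σ` to any
superset `L`, keeping the positions `< s`), `prefix_image_of_eqOn` (agreement below `s` preserves all
prefix sets of size `≤ s`).  No new definitions.  VP ≠ VNP is not moved by this file.
-/

noncomputable section

open Finset

namespace Summit.ValiantsHypothesis.Theorems.RigidityForcesSymmetry.GrenetGauge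

open Literature.Computability.AlgebraicComplexity

variable {n : ℕ}

/-- Orderings that agree below `s` have the same prefix sets of size `t ≤ s`. [folklore] -/
theorem prefix_image_of_eqOn {σ π : Equiv.Perm (Fin n)} {s : ℕ} (h : ∀ i : Fin n, (i : ℕ) < s → π i = σ i)
    {t : ℕ} (ht : t ≤ s) :
    (univ.filter fun i : Fin n => (i : ℕ) < t).image π = (univ.filter fun i : Fin n => (i : ℕ) < t).image σ :=
  Grenet.prefix_image_eq_of_eqOn_lt (fun i hi => h i hi) ht

/-- Extending a prefix by one prescribed letter, keeping the earlier positions: if `σ({i < |S|}) = S`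
and `x ∉ S`, some `σ'` agrees with `σ` below `|S|` and has `σ' |S| = x`. [folklore] -/
theorem exists_perm_prefix_insert_eqOn {S : Finset (Fin n)} {σ : Equiv.Perm (Fin n)}
    (hσ : (univ.filter fun i : Fin n => (i : ℕ) < S.card).image σ = S) {x : Fin n} (hx : x ∉ S) :
    ∃ σ' : Equiv.Perm (Fin n), (∀ i : Fin n, (i : ℕ) < S.card → σ' i = σ i) ∧
      ∃ hlt : S.card < n, σ' ⟨S.card, hlt⟩ = x := by
  have hlt : S.card < n := by
    have h1 : (insert x S).card ≤ n := (Finset.card_le_univ _).trans_eq (Fintype.card_fin n)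
    rw [Finset.card_insert_of_notMem hx] at h1
    omega
  have hi₀ : S.card ≤ ((σ.symm x : Fin n) : ℕ) := by
    by_contra hle
    have hmem : x ∈ (univ.filter fun i : Fin n => (i : ℕ) < S.card).image σ :=
      (Grenet.mem_prefix_image σ _ x).mpr (not_le.mp hle)
    rw [hσ] at hmem
    exact hx hmem
  refine ⟨σ * Equiv.swap (σ.symm x) ⟨S.card, hlt⟩, fun i hi => ?_, hlt, ?_⟩
  · rw [Equiv.Perm.mul_apply, Equiv.swap_apply_of_ne_of_ne]
    · intro h'; rw [h'] at hi; omega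
    · intro h'; have := congrArg Fin.val h'; simp only at this; omega
  · rw [Equiv.Perm.mul_apply, Equiv.swap_apply_right, Equiv.apply_symm_apply]

/-- **Extending a prefix to a superset, keeping the earlier positions.**  If the `s`-prefix set of `σ`
is contained in `L`, some `π` agrees with `σ` below `s` and has `|L|`-prefix set `L`. [folklore] -/
theorem exists_perm_prefix_extend (σ : Equiv.Perm (Fin n)) {s : ℕ} (hs : s ≤ n) (L : Finset (Fin n))
    (hL : (univ.filter fun i : Fin n => (i : ℕ) < s).image σ ⊆ L) :
    ∃ π : Equiv.Perm (Fin n), (∀ i : Fin n, (i : ℕ) < s → π i = σ i) ∧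
      (univ.filter fun i : Fin n => (i : ℕ) < L.card).image π = L := by
  classical
  set P := (univ.filter fun i : Fin n => (i : ℕ) < s).image σ with hP
  have hPcard : P.card = s := Grenet.card_prefix_image σ hs
  -- induction on the part of `L` outside the prefix
  suffices key : ∀ D : Finset (Fin n), Disjoint P D → ∃ π : Equiv.Perm (Fin n),
      (∀ i : Fin n, (i : ℕ) < s → π i = σ i) ∧
      (univ.filter fun i : Fin n => (i : ℕ) < (P ∪ D).card).image π = P ∪ D by
    obtain ⟨π, h1, h2⟩ := key (L \ P) Finset.disjoint_sdiff
    rw [Finset.union_sdiff_of_subset hL] at h2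
    exact ⟨π, h1, h2⟩
  intro D
  induction D using Finset.induction_on with
  | empty =>
    intro _
    refine ⟨σ, fun i _ => rfl, ?_⟩
    rw [Finset.union_empty, hPcard]
  | @insert x D hxD ih =>
    intro hdisj
    have hdisj' : Disjoint P D := Finset.disjoint_of_subset_right (Finset.subset_insert _ _) hdisj
    obtain ⟨π₀, hπ₀, hP₀⟩ := ih hdisj'
    have hxP : x ∉ P := fun h => Finset.disjoint_left.mp hdisj h (Finset.mem_insert_self _ _)
    have hx : x ∉ P ∪ D := fun h => (Finset.mem_union.mp h).elim hxP hxD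
    obtain ⟨π₁, hπ₁, hlt, hπ₁x⟩ := exists_perm_prefix_insert_eqOn hP₀ hx
    have hcardPD : s ≤ (P ∪ D).card := by rw [← hPcard]; exact Finset.card_le_card Finset.subset_union_left
    refine ⟨π₁, fun i hi => (hπ₁ i (by omega)).trans (hπ₀ i hi), ?_⟩
    have hcard : (P ∪ insert x D).card = (P ∪ D).card + 1 := by
      rw [Finset.union_insert, Finset.card_insert_of_notMem hx]
    rw [hcard, Grenet.prefix_image_succ π₁ hlt, hπ₁x, prefix_image_of_eqOn hπ₁ le_rfl, hP₀, Finset.union_insert]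

end Summit.ValiantsHypothesis.Theorems.RigidityForcesSymmetry.GrenetGauge
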